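import Summits.BirchSwinnertonDyer.Rank1Residual.X11b.FrameBinomialUnit
import Summits.BirchSwinnertonDyer.Rank1Residual.X11b.BDPValueRigidityInt
import HarnessLib

/-!
# X11b — IDEAL RIGIDITY ACROSS PERIODS: two BDP frames of the same `(ι, 𝔭, κ, γ, f)` with ANY non-zero
# periods differ by a UNIT of `𝓞_{ℂ_p}⟦T⟧`; in particular they generate the SAME IDEAL, and the
# main-conjecture conjunct `R1.IMCEqIntAt` does not see the frame

HONEST FRAMING (cell `b2b-bsdres`, run/shared/lean/b2b/bsd-rank1-residual/, verbatim in every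
file): the goal of the cell is to DELETE the COMBINATION-SHAPED residual classes of the
Birch–Swinnerton-Dyer formula for ALL analytic-rank `≤ 1` elliptic curves over `ℚ` — "full BSD
formula for every rank `≤ 1` curve in class `C`" assembled STRICTLY from published theorems — so
that the rank-`≤ 1` remainder becomes exactly the CONSTRUCTION-SHAPED classes, which are TYPED
(missing-input `Prop`s), NOT attempted. This is not "finishing BSD". Sub-cell
`b2b-bsdres-multr1-p1` (X11b, route R1, gen 25); THEOREMS ONLY (no definition, no named fact, no
`sorry`); valid at every ODD prime `p`; nothing here changes a label.

## What this file proves (INTENT HOME/INBOX.md 2026-08-21, steps I–III in `FrameMahlerBound`,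
## `FramePrincipalUnitPowers`, `FrameSeparation`, `FrameRigidityKernel`, `FrameBinomialUnit`)

* §1 **`R1.exists_unit_mul_eq_of_values`** (abstract): `Q, Q' ∈ 𝓞_{ℂ_p}⟦T⟧` with values
  `Q'(x^j − 1) = b^j·Q(x^j − 1)` (`j ≥ 1`) along the powers of a principal unit `x ≠ 1` with
  `‖x − 1‖ < p⁻¹`, `b ≠ 0` ⟹ `Q' = U·Q` for a UNIT `U` (if `b` is separated from `x^ℤ` both vanish
  — `FrameRigidityKernel`; otherwise `b = x^σ` and `U = (1+T)^σ` — `FrameBinomialUnit`).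
* §2 **`R1.exists_unit_mul_eq_of_isBDPLFunctionInt`**: at an odd prime `p`, over an imaginary
  quadratic `K`, for an anticyclotomic `κ` with topological generator `γ`: two ♭-frames
  `R1.IsBDPLFunctionInt p ι 𝔭 κ γ f Ω_K Ω_p Q`, `… Ω_K' Ω_p' Q'` with non-zero periods satisfy
  `Q' = U·Q`, `U` a unit (the points are the values at `γ` of the powers of multr1-p2's interpolation
  character; the ratio is `b = β^{m p^a}`, `β = ι⁻¹((Ω_K/Ω_K')⁴)(Ω_p'/Ω_p)⁴`, by multr1-p2's
  `intSeries_hasValueAt_frame_rescale`); **`R1.span_singleton_eq_of_isBDPLFunctionInt`**: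
  `Ideal.span {Q'} = Ideal.span {Q}`; **`R1.imcEqIntAt_iff_of_isBDPLFunctionInt`**: the
  main-conjecture conjunct `R1.IMCEqIntAt` of route R1's open input holds for one ♭-frame iff for any
  other — the ∀-frame and ∃-frame currencies of H3 AGREE given existence. (x11b3's ∀-typed halves at
  `p = 3` and route R1's gen-21 ∀-shape `R1.IMCEqOnTree` are thus readable from ∃-typed refereed
  sources; S27/♭-V1RIG compared only constant terms.)

References: [Castella2018] Thm. 3.1 (arXiv:1704.06608 p. 9); [CastellaHsieh2018] §3.3;
[Washington1997] §5.1 (the functions `(1+T)^x`).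
-/

noncomputable section

open scoped Classical Topology NumberField
open Filter Finset NumberField IsDedekindDomain Field PowerSeries
open Literature.NumberTheory.EllipticCurves Literature.NumberTheory.GaloisRepresentations
open Summit.BirchSwinnertonDyer.Rank1Residual.X11b.Three.LambdaSupply
open Summit.BirchSwinnertonDyer.Rank1Residual.X11b.LambdaSupply
open Summit.BirchSwinnertonDyer.Rank1Residual.X11b.Three.LambdaSupply.PadicUnits

namespace Summit.BirchSwinnertonDyer.Rank1Residual.X11b

variable {p : ℕ} [Fact p.Prime]

/-! ### §1 The abstract statement -/

/-- **Frames tied along the powers of a principal unit differ by a unit.** Let `Q, Q' ∈ 𝓞_{ℂ_p}⟦T⟧`,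
`x ∈ ℂ_p` with `‖x − 1‖ < p⁻¹`, `x ≠ 1`, `b ≠ 0`, and values `Q(x^j − 1) = V_j`, `Q'(x^j − 1) = V'_j`
with `V'_j = b^j V_j` for `j ≥ 1`. Then `Q' = U·Q` for a UNIT `U ∈ 𝓞_{ℂ_p}⟦T⟧`. If `b` is separated
from `{x^n}` both series vanish (`R1.eq_zero_of_separated`); otherwise `b = χ(σ)` for the `ℤ_p`-power
character `χ` of `x` and `U = (1+T)^σ` has `U(x^j − 1) = b^j` (`R1.binomialUnit_hasValueAt` with
`ψ = χ^j`), so `Q'` and `U·Q` agree at every `x^j − 1` (identity principle). [cite: Washington1997, §5.1] -/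
theorem R1.exists_unit_mul_eq_of_values {Q Q' : PowerSeries 𝓞_ℂ_[p]} {x b : ℂ_[p]}
    {V V' : ℕ → ℂ_[p]} (hx : ‖x - 1‖ < (p : ℝ)⁻¹) (hx1 : x ≠ 1) (hb : b ≠ 0)
    (hV : ∀ j, IntSeries.HasValueAt Q (x ^ j - 1) (V j))
    (hV' : ∀ j, IntSeries.HasValueAt Q' (x ^ j - 1) (V' j)) (hrel : ∀ j, 0 < j → V' j = b ^ j * V j) :
    ∃ U : PowerSeries 𝓞_ℂ_[p], IsUnit U ∧ Q' = U * Q := by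
  have hp : p.Prime := Fact.out
  have hp1' : (p : ℝ)⁻¹ < 1 := inv_lt_one_of_one_lt₀ (by exact_mod_cast hp.one_lt)
  have hxlt : ‖x - 1‖ < 1 := hx.trans hp1'
  by_cases hsep : ∃ δ : ℝ, 0 < δ ∧ ∀ n : ℤ, δ ≤ ‖b - x ^ n‖
  · obtain ⟨δ, hδ0, hδ⟩ := hsep
    refine ⟨1, isUnit_one, ?_⟩
    rw [R1.eq_zero_of_separated hx hx1 hb hδ0 hδ hV hV' hrel,
      R1.eq_zero_of_separated' hx hx1 hb hδ0 hδ hV hV' hrel, mul_zero]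
  · -- `b = χ(σ)` for the `ℤ_p`-power character of `x`
    obtain ⟨χ, hχc, hχ1, -⟩ := exists_zpPow (p := p) (F := ℂ_[p]) (b := x)
      (by rwa [← norm_neg, neg_sub])
    obtain ⟨σ, hσ⟩ := R1.mem_range_of_not_separated χ hχc hχ1 hsep
    set U : PowerSeries 𝓞_ℂ_[p] := (binomialSeries ℤ_[p] (Multiplicative.toAdd σ)).map (R1.toCpInt p)
      with hU
    refine ⟨U, R1.isUnit_binomialUnit _, ?_⟩
    -- values of `U` at `x^j − 1`: `b^j`, through the character `χ^j`
    have hUval : ∀ j : ℕ, IntSeries.HasValueAt U (x ^ j - 1) (b ^ j) := by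
      intro j
      set ψ : Multiplicative ℤ_[p] →* ℂ_[p]ˣ := (powMonoidHom j).comp χ with hψ
      have hψc : Continuous ψ := (continuous_pow j).comp hχc
      have hψ1 : ((ψ (Multiplicative.ofAdd 1) : ℂ_[p]ˣ) : ℂ_[p]) = x ^ j := by
        rw [hψ, MonoidHom.comp_apply, powMonoidHom_apply, Units.val_pow_eq_pow_val, hχ1]
      have h := R1.binomialUnit_hasValueAt ((R1.norm_pow_sub_one_le hxlt j).trans_lt hxlt)
        ψ hψc hψ1 (Multiplicative.toAdd σ)
      rw [ofAdd_toAdd, hψ, MonoidHom.comp_apply, powMonoidHom_apply, Units.val_pow_eq_pow_val, hσ] at h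
      exact h
    -- `Q'` and `U·Q` agree at `x^j − 1`, `j ≥ 1`
    have hUQ : ∀ j, 0 < j → IntSeries.HasValueAt (U * Q) (x ^ j - 1) (V' j) := by
      intro j hj
      rw [hrel j hj]
      exact intSeries_hasValueAt_mul ((R1.norm_pow_sub_one_le hxlt j).trans_lt hxlt) (hUval j) (hV j)
    -- identity principle along `x^{p^k} − 1`
    have hlim : Tendsto (fun k : ℕ ↦ x ^ p ^ k - 1) atTop (𝓝 0) := by
      have h := (tendsto_pow_prime_pow_padicComplex (p := p) hxlt).sub_const 1
      rwa [sub_self] at h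
    have hne : ∃ᶠ k in atTop, x ^ p ^ k - 1 ≠ 0 := by
      refine Frequently.of_forall fun k h => hx1 ?_
      have hk : ‖x ^ p ^ k - 1‖ = ((p : ℝ)⁻¹) ^ k * ‖x - 1‖ := R1.norm_pow_prime_pow_sub_one hx k
      rw [h, norm_zero] at hk
      have hpk : 0 < ((p : ℝ)⁻¹) ^ k := pow_pos (inv_pos.mpr (by exact_mod_cast hp.pos)) k
      have : ‖x - 1‖ = 0 := by nlinarith [norm_nonneg (x - 1)]
      exact sub_eq_zero.mp (norm_eq_zero.mp this)
    exact R1.intSeries_eq_of_hasValueAt (x := fun k => x ^ p ^ k - 1) (v := fun k => V' (p ^ k)) hlim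
      hne (fun k => hV' (p ^ k)) (fun k => hUQ (p ^ k) (pow_pos hp.pos k))

/-! ### §2 BDP frames over the wide receptacle -/

section Frames

variable {K : Type} [Field K] [NumberField K] {N : ℕ} {ι : PadicAlgCl p ≃+* ℂ}
  {𝔭 : HeightOneSpectrum (𝓞 K)} {κ : ZpExtension K p} {γ : Field.absoluteGaloisGroup K}
  {f : CuspForm (CongruenceSubgroup.Gamma0 N) 2} {ΩK ΩK' : ℂ} {Ωp Ωp' : ℂ_[p]}
  {Q Q' : PowerSeries 𝓞_ℂ_[p]}

/-- **IDEAL RIGIDITY ACROSS PERIODS — two ♭-frames differ by a unit.** At an odd prime `p`, over an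
imaginary quadratic `K`, for an anticyclotomic `κ` with topological generator `γ`: if
`R1.IsBDPLFunctionInt p ι 𝔭 κ γ f Ω_K Ω_p Q` and `R1.IsBDPLFunctionInt p ι 𝔭 κ γ f Ω_K' Ω_p' Q'` with all
periods non-zero, then `Q' = U·Q` for a unit `U` of `𝓞_{ℂ_p}⟦T⟧`. The test points are the values at `γ`
of the powers `φ₀^{p^a j}` of multr1-p2's interpolation character (`exists_interpolationCharacter`),
`a` chosen with `‖φ̂₀(γ)^{p^a} − 1‖ < p⁻¹`; the two frames' values there differ by `β^{m p^a j}`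
(`intSeries_hasValueAt_frame_rescale`); §1 applies. [cite: Castella2018, Thm. 3.1 (arXiv:1704.06608 p. 9)]
[cite: CastellaHsieh2018, §3.3, Def. 3.5 and Prop. 3.6] -/
theorem R1.exists_unit_mul_eq_of_isBDPLFunctionInt (hp2 : p ≠ 2) (hK : IsImaginaryQuadratic K)
    (hκ : κ.IsAnticyclotomic) (hγ : κ.IsTopGenerator γ) (hΩK : ΩK ≠ 0) (hΩK' : ΩK' ≠ 0)
    (hΩp : Ωp ≠ 0) (hΩp' : Ωp' ≠ 0) (hQ : R1.IsBDPLFunctionInt p ι 𝔭 κ γ f ΩK Ωp Q)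
    (hQ' : R1.IsBDPLFunctionInt p ι 𝔭 κ γ f ΩK' Ωp' Q') :
    ∃ U : PowerSeries 𝓞_ℂ_[p], IsUnit U ∧ Q' = U * Q := by
  have hp : p.Prime := Fact.out
  -- the interpolation character and its value at `γ`
  obtain ⟨φ₀, m, ψ, hm, hunr, hinf, hav, hfac, hx1, hne⟩ :=
    exists_interpolationCharacter hp2 ι K κ hK hκ γ hγ
  set e := (FramedRep.unitsContinuousMulEquivOfUnique (Fin 1) (PadicAlgCl p) :
    (PadicAlgCl p)ˣ →ₜ* GL (Fin 1) (PadicAlgCl p)) with he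
  set x₀ : ℂ_[p] := avatarValueAt (e.comp ψ) γ with hx₀
  have hunr' : ∀ v : HeightOneSpectrum (𝓞 K), ((p : ℕ) : 𝓞 K) ∉ v.asIdeal → φ₀.IsUnramifiedAt v :=
    fun v _ => hunr v
  -- `a` with `‖x₀^{p^a} − 1‖ < p⁻¹`
  have hpinv : 0 < (p : ℝ)⁻¹ := inv_pos.mpr (by exact_mod_cast hp.pos)
  obtain ⟨a, ha⟩ : ∃ a : ℕ, ‖x₀ ^ p ^ a - 1‖ < (p : ℝ)⁻¹ := by
    have h := tendsto_pow_prime_pow_padicComplex (p := p) hx1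
    have hev := h.eventually (Metric.ball_mem_nhds (1 : ℂ_[p]) hpinv)
    obtain ⟨a, ha⟩ := hev.exists
    exact ⟨a, by rwa [dist_eq_norm] at ha⟩
  set x : ℂ_[p] := x₀ ^ p ^ a with hxdef
  have hxne : x ≠ 1 := hne a
  have hxlt : ‖x - 1‖ < 1 := ha.trans (inv_lt_one_of_one_lt₀ (by exact_mod_cast hp.one_lt))
  -- generic values of `Q`, `Q'` at the points `x^j − 1`
  have hpt : ∀ j : ℕ, ‖x ^ j - 1‖ < 1 := fun j => (R1.norm_pow_sub_one_le hxlt j).trans_lt hxlt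
  choose V hV using fun j : ℕ => intSeries_exists_hasValueAt Q (hpt j)
  choose V' hV' using fun j : ℕ => intSeries_exists_hasValueAt Q' (hpt j)
  -- the period ratio
  set β : ℂ_[p] := ((ι.symm ((ΩK / ΩK') ^ 4) : PadicAlgCl p) : ℂ_[p]) * (Ωp' / Ωp) ^ 4 with hβ
  have hβ0 : β ≠ 0 := by
    refine mul_ne_zero ?_ (pow_ne_zero _ (div_ne_zero hΩp' hΩp))
    rw [PadicComplex.coe_eq]
    exact (map_ne_zero_iff _ (algebraMap (PadicAlgCl p) ℂ_[p]).injective).mpr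
      ((map_ne_zero_iff _ ι.symm.injective).mpr (pow_ne_zero _ (div_ne_zero hΩK hΩK')))
  set b : ℂ_[p] := β ^ (m * p ^ a) with hbdef
  have hb : b ≠ 0 := pow_ne_zero _ hβ0
  -- the relation `V' j = b^j V j` for `j ≥ 1`, through the characters `φ₀^{p^a j}`
  have hrel : ∀ j, 0 < j → V' j = b ^ j * V j := by
    intro j hj
    set n : ℕ := p ^ a * j with hn
    have hn0 : 0 < m * n := Nat.mul_pos hm (Nat.mul_pos (pow_pos hp.pos a) hj)
    have hunrn : ∀ v : HeightOneSpectrum (𝓞 K), (φ₀ ^ n).IsUnramifiedAt v :=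
      fun v => isUnramifiedAt_pow' (hunr v) n
    have hinfn : (φ₀ ^ n).HasInfinityType (fun _ ↦ ((m * n : ℕ) : ℤ)) (fun _ ↦ -((m * n : ℕ) : ℤ)) := by
      have h := HasInfinityType.pow_nat hinf n
      convert h using 2 <;> push_cast <;> ring
    have havn : IsPAdicAvatarOf ι (φ₀ ^ n) (e.comp (ψ ^ n)) := isPAdicAvatarOf_pow ι hav hunr' n
    have hfacn : FactorsThroughZp κ (e.comp (ψ ^ n)) := factorsThroughZp_unitsChar_pow κ hfac n
    have hvaln : avatarValueAt (e.comp (ψ ^ n)) γ = x ^ j := by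
      rw [avatarValueAt_unitsChar_pow, ← hx₀, hxdef, ← pow_mul, hn]
    -- the values of the two frames at `x^j − 1`
    have h1 := hQ (φ₀ ^ n) (m * n) hn0 hunrn hinfn (e.comp (ψ ^ n)) havn hfacn
    have h2 := intSeries_hasValueAt_frame_rescale hΩK hΩK' hΩp hQ' hn0 hunrn hinfn havn hfacn
    rw [hvaln] at h1 h2
    have e1 : V j = _ := (hV j).unique h1
    have e2 : V' j = _ := (hV' j).unique h2
    rw [e2, e1, hbdef, ← hβ, ← pow_mul, show m * p ^ a * j = m * n by rw [hn]; ring]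
    ring
  exact R1.exists_unit_mul_eq_of_values ha hxne hb hV hV' hrel

/-- **Two ♭-frames generate the same ideal**: `Ideal.span {Q'} = Ideal.span {Q}`.
[cite: Castella2018, Thm. 3.1 (arXiv:1704.06608 p. 9)] -/
theorem R1.span_singleton_eq_of_isBDPLFunctionInt (hp2 : p ≠ 2) (hK : IsImaginaryQuadratic K)
    (hκ : κ.IsAnticyclotomic) (hγ : κ.IsTopGenerator γ) (hΩK : ΩK ≠ 0) (hΩK' : ΩK' ≠ 0)
    (hΩp : Ωp ≠ 0) (hΩp' : Ωp' ≠ 0) (hQ : R1.IsBDPLFunctionInt p ι 𝔭 κ γ f ΩK Ωp Q)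
    (hQ' : R1.IsBDPLFunctionInt p ι 𝔭 κ γ f ΩK' Ωp' Q') :
    Ideal.span ({Q'} : Set (PowerSeries 𝓞_ℂ_[p])) = Ideal.span {Q} := by
  obtain ⟨U, hU, hUQ⟩ := R1.exists_unit_mul_eq_of_isBDPLFunctionInt hp2 hK hκ hγ hΩK hΩK' hΩp hΩp' hQ hQ'
  rw [hUQ]
  exact Ideal.span_singleton_mul_left_unit hU Q

variable {W : WeierstrassCurve ℚ}

/-- **The main-conjecture conjunct does not see the frame.** For two ♭-frames of the same
`(ι, 𝔭, κ, γ, f)` (odd `p`, `K` imaginary quadratic, `κ` anticyclotomic, non-zero periods):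
`R1.IMCEqIntAt W p κ 𝔭 γ Q ↔ R1.IMCEqIntAt W p κ 𝔭 γ Q'` — the erratum's equality
`Ch_Λ(X_ac)·𝓞_{ℂ_p}⟦T⟧ = (Q)` holds for one frame iff for any other. So the ∃-frame and ∀-frame typings
of the main-conjecture half agree given the existence of a frame.
[cite: Castella2018Erratum, Thm. 1.1 (p. 1)] [cite: Castella2018, Thm. 3.1 (arXiv:1704.06608 p. 9)] -/
theorem R1.imcEqIntAt_iff_of_isBDPLFunctionInt (hp2 : p ≠ 2) (hK : IsImaginaryQuadratic K)
    (hκ : κ.IsAnticyclotomic) [hγ : Fact (κ.IsTopGenerator γ)] (hΩK : ΩK ≠ 0) (hΩK' : ΩK' ≠ 0)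
    (hΩp : Ωp ≠ 0) (hΩp' : Ωp' ≠ 0) (hQ : R1.IsBDPLFunctionInt p ι 𝔭 κ γ f ΩK Ωp Q)
    (hQ' : R1.IsBDPLFunctionInt p ι 𝔭 κ γ f ΩK' Ωp' Q') :
    R1.IMCEqIntAt W p κ 𝔭 γ Q ↔ R1.IMCEqIntAt W p κ 𝔭 γ Q' := by
  unfold R1.IMCEqIntAt
  rw [R1.span_singleton_eq_of_isBDPLFunctionInt hp2 hK hκ hγ.out hΩK hΩK' hΩp hΩp' hQ hQ']

end Frames

end Summit.BirchSwinnertonDyer.Rank1Residual.X11b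

end
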